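import Summits.ResolutionOfSingularities.ResolutionOfSingularities.Theorems.FrobeniusLadderFInjectiveMacaulayficationLoopGermLCharts
import Summits.ResolutionOfSingularities.ResolutionOfSingularities.Theorems.FrobeniusLadderFInjectiveMacaulayficationStrictTransformChartN
import Summits.ResolutionOfSingularities.ResolutionOfSingularities.Theorems.FrobeniusLadderFInjectiveMacaulayficationPrimeTransfer
import Summits.ResolutionOfSingularities.ResolutionOfSingularities.Theorems.FrobeniusLadderFInjectiveMacaulayficationPointFixableOfCert
import Summits.ResolutionOfSingularities.ResolutionOfSingularities.Theorems.FrobeniusLadderFInjectiveMacaulayficationE8Char5FiModel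
import Summits.ResolutionOfSingularities.ResolutionOfSingularities.Theorems.FrobeniusLadderFInjectiveMacaulayficationCertifiedCoverCongr
import Summits.ResolutionOfSingularities.ResolutionOfSingularities.Theorems.FrobeniusLadderFInjectiveMacaulayficationReesChartFacts
import Summits.ResolutionOfSingularities.ResolutionOfSingularities.Theorems.FrobeniusLadderFRationalResolutionFRationalCM
import HarnessLib

/-!
# (O-3) ★★ THE LOOP GERM IS CURED IN ONE SINGULAR-PLANE STEP: `Bl_{(c,d,e)} U₀` is FULL over the centre
# (crux `FInjectiveMacaulayfication` stmt-ResolutionOfSingularities-15315, chain w45a; res-L1-w45a-plan-1 g19 RULING R19.18; seat res-L1-w45a-stub-3 g10)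

[OURS · L1 W4.5a] Support file (`--supports stmt-ResolutionOfSingularities-15315 --as helper`); unconditional; def-free; replaces the role of NO printed item;
NOT a statement of the manuscript; AI-written (AI review is weaker than expert review).

SETTING. `U₀ = Spec k[a,b,c,d,e]/(L)`, `L = e² + a²ce + ac² + acd² + ab³c²` (`char k = 2`), the loop germ of the rad-τ tower of d4lx6q7 (R19.16). We present
`k[a,b,c,d,e] = k₀[c,d,e]`, `k₀ := k[a,b]` (outer variables `X0, X1, X2 = c, d, e`; coefficients `a, b`), so that the blow-up of the PLANE `V(c,d,e) ⊂ 𝔸⁵_k` is the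
blow-up of the POINT `(c,d,e)` of `𝔸³_{k₀}` and the tree's point-centre chart identification (`StrictTransformChartN.exists_ringEquiv`, any commutative base ring)
applies verbatim. §1 is GENERIC in the coefficient domain `A ∋ a, b` (so that no nested polynomial ring is ever localised in a statement): `theta` (the three
substitutions), `prime_G` (strict transforms prime, `PrimeTransfer`), ★ `hon_chart` (the clause on each vertex chart of `Bl U₀`, transported from a supplied clause on
`A[c,d,e]/(L_j)`), ★★ `cure_over_of_clauses` (FULL over the centre, by `PointFixableOfCert.affineBlowup_fiClause_over_of_cert`; cover with `N = 1`). §2 instantiates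
`A = k[a,b]`: `exists_flatten` (`k₀[c,d,e] ≃ k[a,…,e]`), `exists_presentationEquiv` (`k₀[c,d,e]/(L) ≃ k[a,…,e]/(L)` matching generators — so `U₀` below IS the desk's
`U₀` with centre `(c̄,d̄,ē)`), `prime_F`, `not_mem_span_X`, `clause_flat` (the clauses of `LoopGermLCharts.clause_chart_c/d/e` moved to `k₀[c,d,e]/(L_j)`), and the
MAIN THEOREM ★★ `loopGerm_cure_over`: for the explicit model `affineBlowup (c̄,d̄,ē) → U₀`, EVERY STALK OVER THE CENTRE IS FULL (`FullCl 2`: a domain, Cohen–Macaulay,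
F-injective). NOT claimed here: FULL at points of the blow-up OFF the centre (there `U₀` is not regular — `Sing U₀ ⊇ V(a,c,e)` — but F-pure; sequel), nor the transport
to an arbitrary `IsBlowup`. [folklore mathematics, OURS as a certificate; cite: Fedder1983, Thm. 1.12; StacksProject, Tag 0804 and Tag 080E; Kollar2007, §2.5]
-/

-- single-problem summit: the doubled namespace component is forced
set_option linter.dupNamespace false

noncomputable section

open AlgebraicGeometry CategoryTheory Literature.AlgebraicGeometry.Resolution TopologicalSpace IsLocalRing MvPolynomial

namespace Summit.ResolutionOfSingularities.ResolutionOfSingularities.Theorems.FInjectiveMacaulayfication.LoopGermLCure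

open Summit.ResolutionOfSingularities.ResolutionOfSingularities.Theorems.FInjectiveMacaulayfication
open SliceableCentre

/-! ## §1 Generic coefficient domain `A ∋ a, b`: the charts of `Bl_{(c,d,e)} Spec A[c,d,e]/(L)` -/

section Generic

variable (A : Type) [CommRing A] (a b : A)

/-- The three substitutions `θ_j : X_j ↦ X_j, X_l ↦ X_l X_j (l ≠ j)` of `A[c,d,e]` carry `L` to `X_j² · L_j`. [certificate; cite: Kollar2007, §2.5] -/
theorem theta (F : MvPolynomial (Fin 3) A) (hF : F = X 2 ^ 2 + C (a ^ 2) * X 0 * X 2 + C a * X 0 ^ 2 + C a * X 0 * X 1 ^ 2 + C (a * b ^ 3) * X 0 ^ 2)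
    (G : Fin 3 → MvPolynomial (Fin 3) A) (hG : G = ![X 2 ^ 2 + C (a ^ 2) * X 2 + C a + C a * X 0 * X 1 ^ 2 + C (a * b ^ 3),
      X 2 ^ 2 + C (a ^ 2) * X 0 * X 2 + C a * X 0 ^ 2 + C a * X 0 * X 1 + C (a * b ^ 3) * X 0 ^ 2,
      1 + C (a ^ 2) * X 0 + C a * X 0 ^ 2 + C a * X 0 * X 1 ^ 2 * X 2 + C (a * b ^ 3) * X 0 ^ 2]) (j : Fin 3) :
    (aeval fun l : Fin 3 => if l = j then (X j : MvPolynomial (Fin 3) A) else X l * X j) F = X j ^ 2 * G j := by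
  subst hF; subst hG
  fin_cases j <;> simp <;> ring

variable [IsDomain A]

/-- The strict transforms are PRIME in `A[c,d,e]` (`A` a domain), from `Prime L` and `L, L_j ∉ (X_j)`, by `PrimeTransfer.prime_transform_of_prime`. [folklore] -/
theorem prime_G (F : MvPolynomial (Fin 3) A) (hF : F = X 2 ^ 2 + C (a ^ 2) * X 0 * X 2 + C a * X 0 ^ 2 + C a * X 0 * X 1 ^ 2 + C (a * b ^ 3) * X 0 ^ 2)
    (G : Fin 3 → MvPolynomial (Fin 3) A) (hG : G = ![X 2 ^ 2 + C (a ^ 2) * X 2 + C a + C a * X 0 * X 1 ^ 2 + C (a * b ^ 3),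
      X 2 ^ 2 + C (a ^ 2) * X 0 * X 2 + C a * X 0 ^ 2 + C a * X 0 * X 1 + C (a * b ^ 3) * X 0 ^ 2,
      1 + C (a ^ 2) * X 0 + C a * X 0 ^ 2 + C a * X 0 * X 1 ^ 2 * X 2 + C (a * b ^ 3) * X 0 ^ 2]) (hFp : Prime F)
    (hnm : ∀ j : Fin 3, F ∉ Ideal.span {(X j : MvPolynomial (Fin 3) A)} ∧ G j ∉ Ideal.span {(X j : MvPolynomial (Fin 3) A)}) (j : Fin 3) : Prime (G j) := by
  refine PrimeTransfer.prime_transform_of_prime ((aeval fun l : Fin 3 => if l = j then (X j : MvPolynomial (Fin 3) A) else X l * X j).toRingHom)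
    (fun c => ?_) ?_ (fun l hl => ?_) (theta A a b F hF G hG j) (hnm j).1 (hnm j).2 hFp
  · show aeval _ (C c) = C c
    rw [aeval_C]; rfl
  · show aeval _ (X j) = X j
    rw [aeval_X, if_pos rfl]
  · show aeval _ (X l) = X l * X j
    rw [aeval_X, if_neg hl]

set_option maxHeartbeats 800000 in
-- one strict-transform identification, one Rees-chart identification, one clause transport
/-- ★ **The clause on the vertex chart `D₊(x̄_j t)` of `Bl_{(c̄,d̄,ē)} Spec A[c,d,e]/(L)`**: the chart ring is `≅ A[c,d,e]/(L_j)` (`StrictTransformChartN.exists_ringEquiv`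
∘ `ReesChartFacts.exists_reesChartEquiv`), so a CM + Frobenius-closed clause at every maximal ideal of `A[c,d,e]/(L_j)` transports to every maximal ideal of the
chart ring (`E8Char5FiModel.clause_maximal_of_ringEquiv`). [folklore glue] -/
theorem hon_chart (F : MvPolynomial (Fin 3) A) (hF : F = X 2 ^ 2 + C (a ^ 2) * X 0 * X 2 + C a * X 0 ^ 2 + C a * X 0 * X 1 ^ 2 + C (a * b ^ 3) * X 0 ^ 2)
    (G : Fin 3 → MvPolynomial (Fin 3) A) (hG : G = ![X 2 ^ 2 + C (a ^ 2) * X 2 + C a + C a * X 0 * X 1 ^ 2 + C (a * b ^ 3),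
      X 2 ^ 2 + C (a ^ 2) * X 0 * X 2 + C a * X 0 ^ 2 + C a * X 0 * X 1 + C (a * b ^ 3) * X 0 ^ 2,
      1 + C (a ^ 2) * X 0 + C a * X 0 ^ 2 + C a * X 0 * X 1 ^ 2 * X 2 + C (a * b ^ 3) * X 0 ^ 2]) (hFp : Prime F)
    (hnm : ∀ j : Fin 3, F ∉ Ideal.span {(X j : MvPolynomial (Fin 3) A)} ∧ G j ∉ Ideal.span {(X j : MvPolynomial (Fin 3) A)})
    (hcl : ∀ (j : Fin 3) (Q' : Ideal (MvPolynomial (Fin 3) A ⧸ Ideal.span {G j})) [Q'.IsMaximal],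
      ∀ d : ℕ, ringKrullDim (Localization.AtPrime Q') = d → ∀ s : Fin d → Localization.AtPrime Q',
      (Ideal.span (Set.range s)).radical.IsMaximal →
        RingTheory.Sequence.IsWeaklyRegular (Localization.AtPrime Q') (List.ofFn s) ∧
        ∀ y : Localization.AtPrime Q', (∃ n : ℕ, y ^ 2 ^ n ∈ Ideal.span
          ((fun z : Localization.AtPrime Q' => z ^ 2 ^ n) '' (Ideal.span (Set.range s) : Set (Localization.AtPrime Q')))) → y ∈ Ideal.span (Set.range s))
    (j : Fin 3) (Q : Ideal (blowupAlgebra (Ideal.span (Set.range fun l : Fin 3 => Ideal.Quotient.mk (Ideal.span {F}) (X l))) (Ideal.Quotient.mk (Ideal.span {F}) (X j)))) [Q.IsMaximal] :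
    ∀ d : ℕ, ringKrullDim (Localization.AtPrime Q) = d → ∀ s : Fin d → Localization.AtPrime Q,
      (Ideal.span (Set.range s)).radical.IsMaximal →
        RingTheory.Sequence.IsWeaklyRegular (Localization.AtPrime Q) (List.ofFn s) ∧
        ∀ y : Localization.AtPrime Q, (∃ n : ℕ, y ^ 2 ^ n ∈ Ideal.span
          ((fun z : Localization.AtPrime Q => z ^ 2 ^ n) '' (Ideal.span (Set.range s) : Set (Localization.AtPrime Q)))) → y ∈ Ideal.span (Set.range s) := by
  classical
  have hGp := prime_G A a b F hF G hG hFp hnm j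
  have hGprime : (Ideal.span {G j}).IsPrime := (Ideal.span_singleton_prime hGp.ne_zero).mpr hGp
  have hxj : Ideal.Quotient.mk (Ideal.span {F}) (X j) ∈ Ideal.span (Set.range fun l : Fin 3 => Ideal.Quotient.mk (Ideal.span {F}) (X l)) := Ideal.subset_span ⟨j, rfl⟩
  obtain ⟨e₀, -⟩ := StrictTransformChartN.exists_ringEquiv (Ideal.Quotient.mk (Ideal.span {F})) Ideal.Quotient.mk_surjective
    (fun l : Fin 3 => Ideal.Quotient.mk (Ideal.span {F}) (X l)) (i := j) (fun _ => rfl) (fun s => Ideal.Quotient.eq_zero_iff_mem) hGprime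
    (PrimeTransfer.X_not_mem_span_of_isPrime hGprime (hnm j).2)
    ((aeval fun l : Fin 3 => if l = j then (X j : MvPolynomial (Fin 3) A) else X l * X j).toRingHom)
    (fun c => by show aeval _ (C c) = C c; rw [aeval_C]; rfl) (by show aeval _ (X j) = X j; rw [aeval_X, if_pos rfl])
    (fun l hl => by show aeval _ (X l) = X l * X j; rw [aeval_X, if_neg hl]) (theta A a b F hF G hG j)
  obtain ⟨e₁, -⟩ := ReesChartFacts.exists_reesChartEquiv (Ideal.span (Set.range fun l : Fin 3 => Ideal.Quotient.mk (Ideal.span {F}) (X l))) _ hxj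
  exact E8Char5FiModel.clause_maximal_of_ringEquiv 2 (e₀.trans e₁) 0 0 (map_zero _) (fun Q' _ _ => hcl j Q') Q (Ideal.zero_mem Q)

variable [IsNoetherianRing A] [CharP A 2]

set_option maxHeartbeats 800000 in
-- the cover + the assembly engine
/-- ★★ **FULL over the centre, generic coefficients.** `A` a noetherian domain of characteristic `2`, `a b : A`, `U₀ = Spec A[c,d,e]/(L)`; if `L` is prime, `L, L_j ∉ (X_j)`,
and each `A[c,d,e]/(L_j)` carries the CM + Frobenius-closed clause at every maximal ideal, then every stalk of the model `affineBlowup (c̄,d̄,ē)` at a point over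
`V(c̄,d̄,ē)` is FULL (`PointFixableOfCert.affineBlowup_fiClause_over_of_cert`; the charts cover since the `x̄_j` generate the centre). [folklore glue; cite:
StacksProject, Tag 0804] -/
theorem cure_over_of_clauses (F : MvPolynomial (Fin 3) A) (hF : F = X 2 ^ 2 + C (a ^ 2) * X 0 * X 2 + C a * X 0 ^ 2 + C a * X 0 * X 1 ^ 2 + C (a * b ^ 3) * X 0 ^ 2)
    (G : Fin 3 → MvPolynomial (Fin 3) A) (hG : G = ![X 2 ^ 2 + C (a ^ 2) * X 2 + C a + C a * X 0 * X 1 ^ 2 + C (a * b ^ 3),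
      X 2 ^ 2 + C (a ^ 2) * X 0 * X 2 + C a * X 0 ^ 2 + C a * X 0 * X 1 + C (a * b ^ 3) * X 0 ^ 2,
      1 + C (a ^ 2) * X 0 + C a * X 0 ^ 2 + C a * X 0 * X 1 ^ 2 * X 2 + C (a * b ^ 3) * X 0 ^ 2]) (hFp : Prime F)
    (hnm : ∀ j : Fin 3, F ∉ Ideal.span {(X j : MvPolynomial (Fin 3) A)} ∧ G j ∉ Ideal.span {(X j : MvPolynomial (Fin 3) A)})
    (hcl : ∀ (j : Fin 3) (Q' : Ideal (MvPolynomial (Fin 3) A ⧸ Ideal.span {G j})) [Q'.IsMaximal],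
      ∀ d : ℕ, ringKrullDim (Localization.AtPrime Q') = d → ∀ s : Fin d → Localization.AtPrime Q',
      (Ideal.span (Set.range s)).radical.IsMaximal →
        RingTheory.Sequence.IsWeaklyRegular (Localization.AtPrime Q') (List.ofFn s) ∧
        ∀ y : Localization.AtPrime Q', (∃ n : ℕ, y ^ 2 ^ n ∈ Ideal.span
          ((fun z : Localization.AtPrime Q' => z ^ 2 ^ n) '' (Ideal.span (Set.range s) : Set (Localization.AtPrime Q')))) → y ∈ Ideal.span (Set.range s)) :
    ∀ y : ↥(affineBlowup (Ideal.span (Set.range fun l : Fin 3 => Ideal.Quotient.mk (Ideal.span {F}) (X l)))),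
      Ideal.span (Set.range fun l : Fin 3 => Ideal.Quotient.mk (Ideal.span {F}) (X l)) ≤ ((affineBlowup.π _).base y).asIdeal →
      FullCl 2 ((affineBlowup (Ideal.span (Set.range fun l : Fin 3 => Ideal.Quotient.mk (Ideal.span {F}) (X l)))).presheaf.stalk y) := by
  classical
  haveI : Fact (Nat.Prime 2) := ⟨Nat.prime_two⟩
  have hFprime : (Ideal.span {F}).IsPrime := (Ideal.span_singleton_prime hFp.ne_zero).mpr hFp
  haveI : IsDomain (MvPolynomial (Fin 3) A ⧸ Ideal.span {F}) := Ideal.Quotient.isDomain _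
  haveI : CharP (MvPolynomial (Fin 3) A ⧸ Ideal.span {F}) 2 :=
    FRationalResolution.charP_quotient_of_ne_top 2 _ fun h => hFp.not_unit (Ideal.span_singleton_eq_top.mp h)
  have hv : ∀ j : Fin 3, (fun l : Fin 3 => Ideal.Quotient.mk (Ideal.span {F}) (X l)) j ∈ Ideal.span (Set.range fun l : Fin 3 => Ideal.Quotient.mk (Ideal.span {F}) (X l)) :=
    fun j => Ideal.subset_span ⟨j, rfl⟩
  -- the charts cover: the centre is generated by the `x̄_j` (`N = 1`)
  have hcov : (HomogeneousIdeal.irrelevant (reesGrading (Ideal.span (Set.range fun l : Fin 3 => Ideal.Quotient.mk (Ideal.span {F}) (X l))))).toIdeal ≤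
      (Ideal.span (Set.range fun j : Fin 3 => reesT (I := Ideal.span (Set.range fun l : Fin 3 => Ideal.Quotient.mk (Ideal.span {F}) (X l)))
        ((fun l : Fin 3 => Ideal.Quotient.mk (Ideal.span {F}) (X l)) j) (hv j))).radical := by
    refine CertifiedCoverCongr.irrelevant_le_radical_of_sum _ hv fun r hr => ⟨1, Nat.one_pos, ?_⟩
    obtain ⟨c, hc⟩ := Ideal.mem_span_range_iff_exists_fun.mp hr
    refine ⟨c, fun j => by simp, ?_⟩
    rw [pow_one, ← hc]
    refine Finset.sum_congr rfl fun j _ => ?_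
    rw [mul_comm]
  -- the centre generators are nonzero
  have hv0 : ∀ j : Fin 3, (fun l : Fin 3 => Ideal.Quotient.mk (Ideal.span {F}) (X l)) j ≠ 0 := fun j h0 =>
    PrimeTransfer.X_not_mem_span_of_isPrime hFprime (hnm j).1 (Ideal.Quotient.eq_zero_iff_mem.mp h0)
  intro y hy
  exact PointFixableOfCert.affineBlowup_fiClause_over_of_cert 2 _ _ 3 _ hv hcov hv0
    (fun j Q _ _ => hon_chart A a b F hF G hG hFp hnm hcl j Q) y hy

end Generic

/-! ## §2 The loop germ: `A = k₀ = k[a,b]`, `a = X0`, `b = X1` -/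

section LoopGerm

variable (k : Type) [Field k]

/-- ★ The flattening isomorphism `Φ : k₀[c,d,e] ≃ k[a,b,c,d,e]` (`k₀ = k[a,b]`): outer `X0,X1,X2 ↦ X2,X3,X4`, coefficients `C(X0), C(X1) ↦ X0, X1`, scalars to
scalars. [plumbing; `MvPolynomial.sumRingEquiv` + a renaming] -/
theorem exists_flatten : ∃ Φ : MvPolynomial (Fin 3) (MvPolynomial (Fin 2) k) ≃+* MvPolynomial (Fin 5) k,
    Φ (X 0) = X 2 ∧ Φ (X 1) = X 3 ∧ Φ (X 2) = X 4 ∧ Φ (C (X 0)) = X 0 ∧ Φ (C (X 1)) = X 1 ∧ ∀ a : k, Φ (C (C a)) = C a := by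
  refine ⟨(sumRingEquiv k (Fin 3) (Fin 2)).symm.trans
    (renameEquiv k ((_root_.Equiv.sumComm (Fin 3) (Fin 2)).trans finSumFinEquiv)).toRingEquiv, ?_, ?_, ?_, ?_, ?_, ?_⟩
  · rw [RingEquiv.trans_apply, sumRingEquiv_symm_X]
    show rename _ (X (Sum.inl 0)) = X 2
    rw [rename_X]; rfl
  · rw [RingEquiv.trans_apply, sumRingEquiv_symm_X]
    show rename _ (X (Sum.inl 1)) = X 3
    rw [rename_X]; rfl
  · rw [RingEquiv.trans_apply, sumRingEquiv_symm_X]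
    show rename _ (X (Sum.inl 2)) = X 4
    rw [rename_X]; rfl
  · rw [RingEquiv.trans_apply, sumRingEquiv_symm_C_X]
    show rename _ (X (Sum.inr 0)) = X 0
    rw [rename_X]; rfl
  · rw [RingEquiv.trans_apply, sumRingEquiv_symm_C_X]
    show rename _ (X (Sum.inr 1)) = X 1
    rw [rename_X]; rfl
  · intro a
    rw [RingEquiv.trans_apply, sumRingEquiv_symm_C_C]
    show rename _ (C a) = C a
    rw [rename_C]

/-- `Φ` carries the `k₀[c,d,e]`-presentations of `L, L_c, L_d, L_e` to the `k[X]`-polynomials of `LoopGermLCharts`. [certificate] -/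
theorem flatten_values (Φ : MvPolynomial (Fin 3) (MvPolynomial (Fin 2) k) ≃+* MvPolynomial (Fin 5) k)
    (h0 : Φ (X 0) = X 2) (h1 : Φ (X 1) = X 3) (h2 : Φ (X 2) = X 4) (ha : Φ (C (X 0)) = X 0) (hb : Φ (C (X 1)) = X 1) :
    Φ (X 2 ^ 2 + C (X 0 ^ 2) * X 0 * X 2 + C (X 0) * X 0 ^ 2 + C (X 0) * X 0 * X 1 ^ 2 + C (X 0 * X 1 ^ 3) * X 0 ^ 2) = X 4 ^ 2 + X 0 ^ 2 * X 2 * X 4 + X 0 * X 2 ^ 2 + X 0 * X 2 * X 3 ^ 2 + X 0 * X 1 ^ 3 * X 2 ^ 2 ∧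
    Φ (X 2 ^ 2 + C (X 0 ^ 2) * X 2 + C (X 0) + C (X 0) * X 0 * X 1 ^ 2 + C (X 0 * X 1 ^ 3)) = X 4 ^ 2 + X 0 ^ 2 * X 4 + X 0 + X 0 * X 2 * X 3 ^ 2 + X 0 * X 1 ^ 3 ∧
    Φ (X 2 ^ 2 + C (X 0 ^ 2) * X 0 * X 2 + C (X 0) * X 0 ^ 2 + C (X 0) * X 0 * X 1 + C (X 0 * X 1 ^ 3) * X 0 ^ 2) = X 4 ^ 2 + X 0 ^ 2 * X 2 * X 4 + X 0 * X 2 ^ 2 + X 0 * X 2 * X 3 + X 0 * X 1 ^ 3 * X 2 ^ 2 ∧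
    Φ (1 + C (X 0 ^ 2) * X 0 + C (X 0) * X 0 ^ 2 + C (X 0) * X 0 * X 1 ^ 2 * X 2 + C (X 0 * X 1 ^ 3) * X 0 ^ 2) = 1 + X 0 ^ 2 * X 2 + X 0 * X 2 ^ 2 + X 0 * X 2 * X 3 ^ 2 * X 4 + X 0 * X 1 ^ 3 * X 2 ^ 2 := by
  refine ⟨?_, ?_, ?_, ?_⟩ <;> simp only [map_add, map_mul, map_pow, map_one, h0, h1, h2, ha, hb]

/-- ★ **The two presentations of `U₀` agree**: `k₀[c,d,e]/(L) ≃ k[a,b,c,d,e]/(L)` with `c̄, d̄, ē ↦ x̄2, x̄3, x̄4` and `ā, b̄ ↦ x̄0, x̄1`. [plumbing] -/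
theorem exists_presentationEquiv (F : MvPolynomial (Fin 3) (MvPolynomial (Fin 2) k)) (hF : F = X 2 ^ 2 + C (X 0 ^ 2) * X 0 * X 2 + C (X 0) * X 0 ^ 2 + C (X 0) * X 0 * X 1 ^ 2 + C (X 0 * X 1 ^ 3) * X 0 ^ 2)
    (f : MvPolynomial (Fin 5) k) (hf : f = X 4 ^ 2 + X 0 ^ 2 * X 2 * X 4 + X 0 * X 2 ^ 2 + X 0 * X 2 * X 3 ^ 2 + X 0 * X 1 ^ 3 * X 2 ^ 2) :
    ∃ Ψ : (MvPolynomial (Fin 3) (MvPolynomial (Fin 2) k) ⧸ Ideal.span {F}) ≃+* (MvPolynomial (Fin 5) k ⧸ Ideal.span {f}),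
      Ψ (Ideal.Quotient.mk _ (X 0)) = Ideal.Quotient.mk _ (X 2) ∧ Ψ (Ideal.Quotient.mk _ (X 1)) = Ideal.Quotient.mk _ (X 3) ∧
      Ψ (Ideal.Quotient.mk _ (X 2)) = Ideal.Quotient.mk _ (X 4) ∧ Ψ (Ideal.Quotient.mk _ (C (X 0))) = Ideal.Quotient.mk _ (X 0) ∧
      Ψ (Ideal.Quotient.mk _ (C (X 1))) = Ideal.Quotient.mk _ (X 1) := by
  obtain ⟨Φ, h0, h1, h2, ha, hb, -⟩ := exists_flatten k
  have hΦF : Φ F = f := by rw [hF, hf]; exact (flatten_values k Φ h0 h1 h2 ha hb).1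
  have hIJ : Ideal.span {f} = Ideal.map (Φ : MvPolynomial (Fin 3) (MvPolynomial (Fin 2) k) →+* MvPolynomial (Fin 5) k) (Ideal.span {F}) := by
    rw [Ideal.map_span, Set.image_singleton]; simp [hΦF]
  refine ⟨Ideal.quotientEquiv _ _ Φ hIJ, ?_, ?_, ?_, ?_, ?_⟩ <;> simp [h0, h1, h2, ha, hb]

/-- ★ `L` is PRIME in `k₀[c,d,e]` (from `LoopGermLCharts.prime_L` through `Φ`). [folklore] -/
theorem prime_F (F : MvPolynomial (Fin 3) (MvPolynomial (Fin 2) k)) (hF : F = X 2 ^ 2 + C (X 0 ^ 2) * X 0 * X 2 + C (X 0) * X 0 ^ 2 + C (X 0) * X 0 * X 1 ^ 2 + C (X 0 * X 1 ^ 3) * X 0 ^ 2) : Prime F := by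
  obtain ⟨Φ, h0, h1, h2, ha, hb, -⟩ := exists_flatten k
  have hΦF : Φ F = X 4 ^ 2 + X 0 ^ 2 * X 2 * X 4 + X 0 * X 2 ^ 2 + X 0 * X 2 * X 3 ^ 2 + X 0 * X 1 ^ 3 * X 2 ^ 2 := by
    rw [hF]; exact (flatten_values k Φ h0 h1 h2 ha hb).1
  have h := LoopGermLCharts.prime_L k _ rfl
  rw [← hΦF] at h
  exact (MulEquiv.prime_iff Φ).mp h

/-- `L ∉ (X_j)` and `L_j ∉ (X_j)` in `k₀[c,d,e]` (a `k`-point with `X_j = 0` at which the polynomial is `1`). [certificate] -/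
theorem not_mem_span_X (F : MvPolynomial (Fin 3) (MvPolynomial (Fin 2) k)) (hF : F = X 2 ^ 2 + C (X 0 ^ 2) * X 0 * X 2 + C (X 0) * X 0 ^ 2 + C (X 0) * X 0 * X 1 ^ 2 + C (X 0 * X 1 ^ 3) * X 0 ^ 2)
    (G : Fin 3 → MvPolynomial (Fin 3) (MvPolynomial (Fin 2) k)) (hG : G = ![X 2 ^ 2 + C (X 0 ^ 2) * X 2 + C (X 0) + C (X 0) * X 0 * X 1 ^ 2 + C (X 0 * X 1 ^ 3),
      X 2 ^ 2 + C (X 0 ^ 2) * X 0 * X 2 + C (X 0) * X 0 ^ 2 + C (X 0) * X 0 * X 1 + C (X 0 * X 1 ^ 3) * X 0 ^ 2,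
      1 + C (X 0 ^ 2) * X 0 + C (X 0) * X 0 ^ 2 + C (X 0) * X 0 * X 1 ^ 2 * X 2 + C (X 0 * X 1 ^ 3) * X 0 ^ 2]) (j : Fin 3) :
    F ∉ Ideal.span {(X j : MvPolynomial (Fin 3) (MvPolynomial (Fin 2) k))} ∧ G j ∉ Ideal.span {(X j : MvPolynomial (Fin 3) (MvPolynomial (Fin 2) k))} := by
  subst hF; subst hG
  -- evaluation `k₀[c,d,e] → k`: inner point `(a,b) = (1,0)`, outer point killing `X_j`
  have key : ∀ (q : MvPolynomial (Fin 3) (MvPolynomial (Fin 2) k)) (pt : Fin 3 → k), pt j = 0 →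
      MvPolynomial.eval₂Hom (MvPolynomial.eval ![(1 : k), 0]) pt q ≠ 0 → q ∉ Ideal.span {(X j : MvPolynomial (Fin 3) (MvPolynomial (Fin 2) k))} := by
    intro q pt hpt hq h
    rw [Ideal.mem_span_singleton] at h
    obtain ⟨r, hr⟩ := h
    apply hq
    rw [hr, map_mul]
    simp [hpt]
  fin_cases j
  · exact ⟨key _ ![0, 0, 1] rfl (by simp), key _ ![0, 0, 0] rfl (by simp)⟩
  · exact ⟨key _ ![0, 0, 1] rfl (by simp), key _ ![0, 0, 1] rfl (by simp)⟩
  · exact ⟨key _ ![1, 0, 0] rfl (by simp), key _ ![0, 0, 0] rfl (by simp)⟩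

set_option maxHeartbeats 800000 in
-- §1 instantiated + three clause transports along the flattening
/-- ★★ **THE LOOP GERM IS CURED IN ONE SINGULAR-PLANE STEP (over the centre).** `U₀ = Spec k₀[c,d,e]/(L) = Spec k[a,b,c,d,e]/(L)` (`exists_presentationEquiv`),
`L = e² + a²ce + ac² + acd² + ab³c²`, `char k = 2`; `𝓚 = (c̄, d̄, ē)` (a singular plane: `L ∈ (c,d,e)²`, `LoopGermLCharts.L_mem_sq_cde`). For the explicit model
`affineBlowup 𝓚 → U₀`, EVERY STALK AT A POINT OVER `V(𝓚)` IS FULL (a domain, Cohen–Macaulay, F-injective): the three chart rings are `≅ k[X]/(L_c)`, `k[X]/(L_d)`,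
`k[X]/(L_e)`, each with a thin Fedder cell at every maximal ideal (`LoopGermLCharts.clause_chart_c/d/e`). (Contrast: the Frobenius recipe blows up the LINE
`rad τ(L) = (a,c,d,e)` and loops, R19.16.) [OURS; cite: Fedder1983, Thm. 1.12; StacksProject, Tag 0804; Kollar2007, §2.5] -/
theorem loopGerm_cure_over [CharP k 2] (F : MvPolynomial (Fin 3) (MvPolynomial (Fin 2) k)) (hF : F = X 2 ^ 2 + C (X 0 ^ 2) * X 0 * X 2 + C (X 0) * X 0 ^ 2 + C (X 0) * X 0 * X 1 ^ 2 + C (X 0 * X 1 ^ 3) * X 0 ^ 2) :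
    ∀ y : ↥(affineBlowup (Ideal.span (Set.range fun l : Fin 3 => Ideal.Quotient.mk (Ideal.span {F}) (X l)))),
      Ideal.span (Set.range fun l : Fin 3 => Ideal.Quotient.mk (Ideal.span {F}) (X l)) ≤ ((affineBlowup.π _).base y).asIdeal →
      FullCl 2 ((affineBlowup (Ideal.span (Set.range fun l : Fin 3 => Ideal.Quotient.mk (Ideal.span {F}) (X l)))).presheaf.stalk y) := by
  classical
  obtain ⟨Φ, h0, h1, h2, ha, hb, -⟩ := exists_flatten k
  have hv := flatten_values k Φ h0 h1 h2 ha hb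
  refine cure_over_of_clauses (MvPolynomial (Fin 2) k) (X 0) (X 1) F hF _ rfl (prime_F k F hF) (not_mem_span_X k F hF _ rfl) ?_
  intro j Q' _
  -- the `k[X]`-side polynomial of chart `j` and its clause
  obtain ⟨g, hΦg, hcl⟩ : ∃ g : MvPolynomial (Fin 5) k, Φ ((![X 2 ^ 2 + C (X 0 ^ 2) * X 2 + C (X 0) + C (X 0) * X 0 * X 1 ^ 2 + C (X 0 * X 1 ^ 3),
        X 2 ^ 2 + C (X 0 ^ 2) * X 0 * X 2 + C (X 0) * X 0 ^ 2 + C (X 0) * X 0 * X 1 + C (X 0 * X 1 ^ 3) * X 0 ^ 2,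
        1 + C (X 0 ^ 2) * X 0 + C (X 0) * X 0 ^ 2 + C (X 0) * X 0 * X 1 ^ 2 * X 2 + C (X 0 * X 1 ^ 3) * X 0 ^ 2] : Fin 3 → MvPolynomial (Fin 3) (MvPolynomial (Fin 2) k)) j) = g ∧
      ∀ (Q'' : Ideal (MvPolynomial (Fin 5) k ⧸ Ideal.span {g})) [Q''.IsMaximal],
        ∀ d : ℕ, ringKrullDim (Localization.AtPrime Q'') = d → ∀ s : Fin d → Localization.AtPrime Q'',
      (Ideal.span (Set.range s)).radical.IsMaximal →
        RingTheory.Sequence.IsWeaklyRegular (Localization.AtPrime Q'') (List.ofFn s) ∧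
        ∀ y : Localization.AtPrime Q'', (∃ n : ℕ, y ^ 2 ^ n ∈ Ideal.span
          ((fun z : Localization.AtPrime Q'' => z ^ 2 ^ n) '' (Ideal.span (Set.range s) : Set (Localization.AtPrime Q'')))) → y ∈ Ideal.span (Set.range s) := by
    fin_cases j
    · exact ⟨_, hv.2.1, fun Q'' _ => LoopGermLCharts.clause_chart_c k _ rfl Q''⟩
    · exact ⟨_, hv.2.2.1, fun Q'' _ => LoopGermLCharts.clause_chart_d k _ rfl Q''⟩
    · exact ⟨_, hv.2.2.2, fun Q'' _ => LoopGermLCharts.clause_chart_e k _ rfl Q''⟩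
  have hIJ : Ideal.span {(![X 2 ^ 2 + C (X 0 ^ 2) * X 2 + C (X 0) + C (X 0) * X 0 * X 1 ^ 2 + C (X 0 * X 1 ^ 3),
        X 2 ^ 2 + C (X 0 ^ 2) * X 0 * X 2 + C (X 0) * X 0 ^ 2 + C (X 0) * X 0 * X 1 + C (X 0 * X 1 ^ 3) * X 0 ^ 2,
        1 + C (X 0 ^ 2) * X 0 + C (X 0) * X 0 ^ 2 + C (X 0) * X 0 * X 1 ^ 2 * X 2 + C (X 0 * X 1 ^ 3) * X 0 ^ 2] : Fin 3 → MvPolynomial (Fin 3) (MvPolynomial (Fin 2) k)) j} = Ideal.map (Φ.symm : MvPolynomial (Fin 5) k →+* MvPolynomial (Fin 3) (MvPolynomial (Fin 2) k)) (Ideal.span {g}) := by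
    rw [Ideal.map_span, Set.image_singleton]
    have : Φ.symm g = (![X 2 ^ 2 + C (X 0 ^ 2) * X 2 + C (X 0) + C (X 0) * X 0 * X 1 ^ 2 + C (X 0 * X 1 ^ 3),
        X 2 ^ 2 + C (X 0 ^ 2) * X 0 * X 2 + C (X 0) * X 0 ^ 2 + C (X 0) * X 0 * X 1 + C (X 0 * X 1 ^ 3) * X 0 ^ 2,
        1 + C (X 0 ^ 2) * X 0 + C (X 0) * X 0 ^ 2 + C (X 0) * X 0 * X 1 ^ 2 * X 2 + C (X 0 * X 1 ^ 3) * X 0 ^ 2] : Fin 3 → MvPolynomial (Fin 3) (MvPolynomial (Fin 2) k)) j := by rw [← hΦg, RingEquiv.symm_apply_apply]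
    simp [this]
  exact E8Char5FiModel.clause_maximal_of_ringEquiv 2 (Ideal.quotientEquiv _ _ Φ.symm hIJ) 0 0 (map_zero _) (fun Q'' _ _ => hcl Q'') Q' (Ideal.zero_mem Q')

end LoopGerm

end Summit.ResolutionOfSingularities.ResolutionOfSingularities.Theorems.FInjectiveMacaulayfication.LoopGermLCure

end
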